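import Summits.BirchSwinnertonDyer.BirchSwinnertonDyer.Theorems.EisensteinPrimesMazurMCOnCellBTwistbackPartnerClassNumber
import Summits.BirchSwinnertonDyer.BirchSwinnertonDyer.Theorems.PrintCFramJZeroThreeUnitRegimeKroneckerCharacters
import Summits.BirchSwinnertonDyer.Rank1Residual.X12.O11.RouteUPsiD11
import Literature.NumberTheory.LFunctions.PrimitiveQuadraticCharacterEulerForm
import Literature.NumberTheory.LFunctions.KloostermanPrimePower
import Literature.NumberTheory.QuadraticFields.ClassNumberOneGenus
import Mathlib.NumberTheory.LegendreSymbol.JacobiSymbol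
import HarnessLib

set_option linter.dupNamespace false -- `Summit.BirchSwinnertonDyer.BirchSwinnertonDyer.Theorems.…` (summit = sub, D-0017)
set_option autoImplicit false

/-!
# Crux `HeegnerTwistCouplingInSupply` (stmt-BirchSwinnertonDyer-21381) — the Kriz–Li corner's integer certificates ARE CLASS NUMBERS:
# `|Σ_{j<f} χ(j)·j| = f·h(−f)` for a primitive odd quadratic character `χ` mod `f` (Dirichlet's class number formula, tree theorem)

Route `BiquadraticEisensteinDescent` (cell `pub/bsd-wall`, width seat `bsd-wall-cm-bed-w4` g27; `--supports` 21381, helper).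
The Kriz–Li corner files (`…KrizLiCornerQT27*.lean`, `…KrizLiCornerX12*.lean`) and the cell `bsd-print-cfram`'s class theorems carry
Kriz–Li's Bernoulli hypothesis (4) as two INTEGER certificates, `3 ∤ S₁` and `3 ∥ S₂`, decided in the kernel prime by prime. This file
identifies them with the CLASS NUMBERS that KL3-CORNERS-bsd-idea-18-g21 §1–§2 names («(4) ⟺ `3 ∤ h(ℚ(√−3p)) ∧ 3 ∤ h(ℚ(√(p·d_{K′})))`»),
inside the kernel and with NO named fact, from the tree's PROVED Dirichlet class number formula in `B₁`-form
`‖B_{1,χ}‖ = h(−f)` (`EisensteinPrimesMazurMCOnCellBTwistbackPartnerClassNumber.norm_bernoulliOneChar_eq_classNumber`, bsd-eis w3 g7,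
from the Kronecker limit formula) and `‖B_{1,χ}‖ = |Σ F(b)(2b − f)|/(2f)` (`LFunctions.PrimitiveQuadratic.norm_bernoulliOneChar_eq_natAbs_sum_div`):

* §1 ★ `natAbs_sum_mul_eq_mul_classNumber`: for a primitive, quadratic, odd Dirichlet character `χ` mod `f > 4` with integer
  values `F`: `|Σ_{b<f} F(b)·b| = f · h(−f)` (`h(−f) = BinQF.classNumber (−f)`, Cox's form class number); hence
  `three_dvd_sum_iff` (`3 ∤ f`: `3 ∣ Σ ↔ 3 ∣ h(−f)`) and `nine_dvd_sum_iff` (`3 ∥ f`: `3 ∣ Σ`, and `9 ∣ Σ ↔ 3 ∣ h(−f)`).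
* §2 the complex quadratic characters: `(·/q)` (`exists_legendreChar`), `(·/q)(·/r)` mod `qr` (`exists_legendrePairChar`: primitive,
  values, and ODD when `q ≡ 1`, `r ≡ 3 (mod 4)`), `χ₄` (`exists_chiFourChar`), `χ₄·(·/q)(·/r)` mod `4qr` (`exists_chiFourPairChar`:
  primitive, values, ODD when `q ≡ r ≡ 3 (mod 4)`) — products of `changeLevel` lifts as in the cell `bsd-print-cfram`'s
  `exists_chiFortyFour_three`, with `ℚ₃ ↦ ℂ`.
* the four certificate bridges (`3 ∣ S₁(q,r) ↔ 3 ∣ h(−qr)`, `9 ∣ S₂(q) ↔ 3 ∣ h(−3q)`, and the `χ₄` analogues `h(−4qr)`, `h(−12q)`)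
  and the corner theorems re-stated with CLASS-NUMBER hypotheses are in the sequel `…KrizLiCornerClassNumberForm.lean`.

HONEST FRAMING: bookkeeping between two currencies already in the tree (integer Bernoulli sums ↔ form class numbers); no new
mathematics, no named fact, no `sorry`; nothing about the crux, its stubs or BSD is proved. THEOREMS ONLY. Supports stmt-BirchSwinnertonDyer-21381.
[cite: Washington1997, Thm. 4.17] [cite: Cox2013, §1.C Lemma 1.14, §2.A Thm. 2.13, §7.B Thm. 7.7(ii)] [cite: Lang1990, Ch. 2 §1 (B_{1,χ})]
[cite: MontgomeryVaughan2007, Theorem 9.13]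
-/

noncomputable section

open scoped Classical NumberTheorySymbols

namespace Summit.BirchSwinnertonDyer.BirchSwinnertonDyer.Theorems.KrizLiCornerClassNumber

open Finset DirichletCharacter
open Literature.NumberTheory.LFunctions (bernoulliOneChar)
open Literature.NumberTheory.QuadraticFields Literature.NumberTheory.QuadraticFields.Quadratic
  Summit.BirchSwinnertonDyer.Rank1Residual.X12.O11.RouteU
  Summit.BirchSwinnertonDyer.BirchSwinnertonDyer.Theorems.PrintCFram
  Summit.BirchSwinnertonDyer.BirchSwinnertonDyer.Theorems.EisensteinPrimesMazurMCOnCellBTwistbackPartnerClassNumber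

/-! ## §1 `|Σ_{b<f} χ(b)·b| = f·h(−f)` for a primitive odd quadratic `χ` mod `f > 4` -/

section General

variable {f : ℕ} [NeZero f]

/-- A non-trivial Dirichlet character with integer values `F` has `Σ_{b<f} F(b) = 0` (orthogonality over one period).
[cite: Washington1997, Ch. 3 (Dirichlet characters)] -/
theorem sum_values_eq_zero (ψ : DirichletCharacter ℂ f) (hψ : ψ ≠ 1) {F : ℕ → ℤ}
    (hF : ∀ b : ℕ, ψ (b : ZMod f) = (F b : ℂ)) : ∑ b ∈ range f, F b = 0 := by
  have h1 : ∑ x : ZMod f, ψ x = ∑ b ∈ range f, ((F b : ℤ) : ℂ) := by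
    rw [Literature.NumberTheory.LFunctions.sum_zmod_eq_sum_range (fun x : ZMod f => ψ x)]
    exact Finset.sum_congr rfl fun b _ => hF b
  have h2 : ∑ x : ZMod f, ψ x = 0 := MulChar.sum_eq_zero_of_ne_one hψ
  rw [h2, ← Int.cast_sum] at h1
  exact_mod_cast h1.symm

omit [NeZero f] in
/-- An odd Dirichlet character over `ℂ` is non-trivial. [folklore] -/
theorem ne_one_of_odd (ψ : DirichletCharacter ℂ f) (hodd : ψ.Odd) : ψ ≠ 1 := by
  intro h1
  have h : ψ (-1) = -1 := hodd
  rw [h1, MulChar.one_apply (isUnit_one.neg)] at h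
  norm_num at h

/-- ★ **Dirichlet's class number formula as an INTEGER identity**: for a primitive, quadratic, odd Dirichlet character `χ` mod `f > 4`
with integer values `F` (`χ(b) = F(b)`): `|Σ_{b<f} F(b)·b| = f · h(−f)`, `h(−f) = BinQF.classNumber (−f)` (`B_{1,χ} = (1/f)Σ χ(b) b = ∓h`).
From the tree's `‖B_{1,χ}‖ = h(−f)` and `‖B_{1,χ}‖ = |Σ F(b)(2b − f)|/(2f)` with `Σ F(b) = 0`.
[cite: Washington1997, Thm. 4.17] [cite: Cox2013, §7.B Thm. 7.7(ii)] -/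
theorem natAbs_sum_mul_eq_mul_classNumber (hf : 4 < f) (ψ : DirichletCharacter ℂ f) (hprim : ψ.IsPrimitive)
    (hquad : ψ.IsQuadratic) (hodd : ψ.Odd) {F : ℕ → ℤ} (hF : ∀ b : ℕ, ψ (b : ZMod f) = (F b : ℂ)) :
    (∑ b ∈ range f, F b * (b : ℤ)).natAbs = f * BinQF.classNumber (-(f : ℤ)) := by
  have hsum0 := sum_values_eq_zero ψ (ne_one_of_odd ψ hodd) hF
  have h1 := Literature.NumberTheory.LFunctions.PrimitiveQuadratic.norm_bernoulliOneChar_eq_natAbs_sum_div ψ (F := F) (fun b _ => hF b)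
  have h2 := norm_bernoulliOneChar_eq_classNumber hf hprim hquad hodd
  rw [← BinaryQuadraticForm.binQF_classNumber_eq _ (by simp only [Left.neg_neg_iff]; exact_mod_cast (show 0 < f by omega))] at h2
  -- `Σ F(b)(2b − f) = 2 Σ F(b) b`
  have hX : ∑ b ∈ range f, F b * (2 * (b : ℤ) - f) = 2 * ∑ b ∈ range f, F b * (b : ℤ) := by
    have : ∑ b ∈ range f, F b * (2 * (b : ℤ) - f) =
        2 * ∑ b ∈ range f, F b * (b : ℤ) - (f : ℤ) * ∑ b ∈ range f, F b := by
      rw [Finset.mul_sum, Finset.mul_sum, ← Finset.sum_sub_distrib]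
      exact Finset.sum_congr rfl fun b _ => by ring
    rw [this, hsum0, mul_zero, sub_zero]
  rw [h2, hX] at h1
  have hf0 : (0 : ℝ) < 2 * (f : ℝ) := by
    have : (0 : ℝ) < f := by exact_mod_cast (show 0 < f by omega)
    linarith
  have h3 : ((2 * ∑ b ∈ range f, F b * (b : ℤ)).natAbs : ℝ) = 2 * (f * BinQF.classNumber (-(f : ℤ)) : ℕ) := by
    rw [eq_div_iff hf0.ne'] at h1
    push_cast
    linarith
  rw [Int.natAbs_mul, show (2 : ℤ).natAbs = 2 by rfl, Nat.cast_mul, Nat.cast_ofNat] at h3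
  have h4 : ((∑ b ∈ range f, F b * (b : ℤ)).natAbs : ℝ) = ((f * BinQF.classNumber (-(f : ℤ)) : ℕ) : ℝ) := by linarith
  exact_mod_cast h4

/-- **`3 ∣ Σ_{b<f} F(b)·b ↔ 3 ∣ h(−f)`** when `3 ∤ f` (same hypotheses). [cite: Washington1997, Thm. 4.17] -/
theorem three_dvd_sum_iff (hf : 4 < f) (hf3 : ¬ 3 ∣ f) (ψ : DirichletCharacter ℂ f) (hprim : ψ.IsPrimitive)
    (hquad : ψ.IsQuadratic) (hodd : ψ.Odd) {F : ℕ → ℤ} (hF : ∀ b : ℕ, ψ (b : ZMod f) = (F b : ℂ)) :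
    (3 : ℤ) ∣ ∑ b ∈ range f, F b * (b : ℤ) ↔ 3 ∣ BinQF.classNumber (-(f : ℤ)) := by
  have key := natAbs_sum_mul_eq_mul_classNumber hf ψ hprim hquad hodd hF
  rw [show (3 : ℤ) = ((3 : ℕ) : ℤ) by rfl, Int.natCast_dvd, key, Nat.Prime.dvd_mul Nat.prime_three]
  exact ⟨fun h => h.resolve_left hf3, Or.inr⟩

/-- **`3 ∣ Σ_{b<f} F(b)·b`, and `9 ∣ Σ ↔ 3 ∣ h(−f)`**, when `3 ∥ f` (same hypotheses). [cite: Washington1997, Thm. 4.17] -/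
theorem nine_dvd_sum_iff (hf : 4 < f) (hf3 : 3 ∣ f) (hf9 : ¬ 9 ∣ f) (ψ : DirichletCharacter ℂ f) (hprim : ψ.IsPrimitive)
    (hquad : ψ.IsQuadratic) (hodd : ψ.Odd) {F : ℕ → ℤ} (hF : ∀ b : ℕ, ψ (b : ZMod f) = (F b : ℂ)) :
    (3 : ℤ) ∣ ∑ b ∈ range f, F b * (b : ℤ) ∧
      ((3 : ℤ) ^ 2 ∣ ∑ b ∈ range f, F b * (b : ℤ) ↔ 3 ∣ BinQF.classNumber (-(f : ℤ))) := by
  have key := natAbs_sum_mul_eq_mul_classNumber hf ψ hprim hquad hodd hF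
  obtain ⟨g, rfl⟩ := hf3
  have hg3 : ¬ 3 ∣ g := fun h => hf9 (by obtain ⟨k, rfl⟩ := h; exact ⟨k, by ring⟩)
  constructor
  · rw [show (3 : ℤ) = ((3 : ℕ) : ℤ) by rfl, Int.natCast_dvd, key, mul_assoc]
    exact dvd_mul_right 3 _
  · rw [show (3 : ℤ) ^ 2 = ((9 : ℕ) : ℤ) by norm_num, Int.natCast_dvd, key, mul_assoc, show (9 : ℕ) = 3 * 3 by rfl]
    rw [Nat.mul_dvd_mul_iff_left (by norm_num : 0 < 3), Nat.Prime.dvd_mul Nat.prime_three]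
    exact ⟨fun h => h.resolve_left hg3, Or.inr⟩

/-- Products of values in `{0, 1, −1}` lie in `{0, 1, −1}`. [folklore] -/
theorem trichotomy_mul {a b : ℤ} (ha : a = 0 ∨ a = 1 ∨ a = -1) (hb : b = 0 ∨ b = 1 ∨ b = -1) :
    a * b = 0 ∨ a * b = 1 ∨ a * b = -1 := by
  rcases ha with rfl | rfl | rfl <;> rcases hb with rfl | rfl | rfl <;> simp

/-- The Legendre symbol takes values in `{0, 1, −1}`. [folklore] -/
theorem legendreSym_trichotomy (p : ℕ) [Fact p.Prime] (a : ℤ) :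
    legendreSym p a = 0 ∨ legendreSym p a = 1 ∨ legendreSym p a = -1 := by
  rw [jacobiSym.legendreSym.to_jacobiSym]; exact jacobiSym.trichotomy a p

/-- `χ₄` takes values in `{0, 1, −1}` on naturals. [folklore] -/
theorem chiFour_trichotomy (a : ℕ) :
    (ZMod.χ₄ (a : ZMod 4) : ℤ) = 0 ∨ (ZMod.χ₄ (a : ZMod 4) : ℤ) = 1 ∨ (ZMod.χ₄ (a : ZMod 4) : ℤ) = -1 := by
  rw [ZMod.χ₄_nat_eq_if_mod_four]; split_ifs <;> simp

/-- A Dirichlet character over `ℂ` whose values at naturals are integers in `{0, ±1}` is quadratic. [folklore] -/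
theorem isQuadratic_of_values (ψ : DirichletCharacter ℂ f) {F : ℕ → ℤ} (hF : ∀ b : ℕ, ψ (b : ZMod f) = (F b : ℂ))
    (htri : ∀ b : ℕ, F b = 0 ∨ F b = 1 ∨ F b = -1) : ψ.IsQuadratic := by
  intro a
  have ha : ψ a = (F a.val : ℂ) := by rw [← hF a.val, ZMod.natCast_zmod_val]
  rw [ha]
  rcases htri a.val with h | h | h <;> simp [h]

end General

/-! ## §2 The complex quadratic characters `(·/q)`, `(·/q)(·/r)`, `χ₄`, `χ₄·(·/q)(·/r)` -/

section Characters

/-- `(·/q)` as a complex Dirichlet character mod an odd prime `q` (Mathlib's `quadraticChar` composed with `ℤ → ℂ`), its values,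
and non-triviality. [cite: Washington1997, Ch. 3 (the quadratic character of conductor q)] -/
theorem exists_legendreChar (q : ℕ) [hq : Fact q.Prime] (hq2 : q ≠ 2) :
    ∃ χ : DirichletCharacter ℂ q, χ ≠ 1 ∧ ∀ a : ℕ, χ (a : ZMod q) = (legendreSym q (a : ℤ) : ℂ) := by
  refine ⟨(quadraticChar (ZMod q)).ringHomComp (Int.castRingHom ℂ), ?_, fun a => by
    rw [MulChar.ringHomComp_apply, legendreSym, Int.cast_natCast]; rfl⟩
  intro h1
  have hF : ringChar (ZMod q) ≠ 2 := by rw [ZMod.ringChar_zmod_n]; exact hq2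
  obtain ⟨a, ha⟩ := FiniteField.exists_nonsquare hF
  have ha0 : a ≠ 0 := by rintro rfl; exact ha (IsSquare.zero)
  have h := congrArg (fun χ : DirichletCharacter ℂ q => χ a) h1
  simp only [MulChar.ringHomComp_apply, quadraticChar_neg_one_iff_not_isSquare.mpr ha,
    MulChar.one_apply (Ne.isUnit ha0)] at h
  norm_num at h

/-- **`(·/q)(·/r)` as a complex Dirichlet character mod `qr`** (`q ≠ r` odd primes): PRIMITIVE (conductor `qr`), with values
`(a/q)(a/r)` at every natural `a`. [cite: Cox2013, §1.C Lemma 1.14] [cite: MontgomeryVaughan2007, Theorem 9.13] -/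
theorem exists_legendrePairChar {q r : ℕ} [hq : Fact q.Prime] [hr : Fact r.Prime] (hq2 : q ≠ 2) (hr2 : r ≠ 2) (hqr : q ≠ r) :
    ∃ χ : DirichletCharacter ℂ (q * r), χ.IsPrimitive ∧
      ∀ a : ℕ, χ (a : ZMod (q * r)) = ((legendreSym q (a : ℤ) * legendreSym r (a : ℤ) : ℤ) : ℂ) := by
  haveI : NeZero (q * r) := ⟨mul_ne_zero hq.out.ne_zero hr.out.ne_zero⟩
  obtain ⟨χq, hqne, hχq⟩ := exists_legendreChar q hq2
  obtain ⟨χr, hrne, hχr⟩ := exists_legendreChar r hr2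
  refine ⟨changeLevel (dvd_mul_right q r) χq * changeLevel (dvd_mul_left r q) χr, ?_, fun a => ?_⟩
  · have hcq : χq.conductor = q := conductor_eq_of_prime_of_ne_one χq hqne
    have hcr : χr.conductor = r := conductor_eq_of_prime_of_ne_one χr hrne
    rw [isPrimitive_def, conductor_changeLevel_mul_changeLevel _ _ χq χr
      (by rw [hcq, hcr]; exact (Nat.coprime_primes hq.out hr.out).mpr hqr), hcq, hcr]
  · by_cases hu : IsCoprime (a : ℤ) ((q * r : ℕ) : ℤ)
    · rw [show ((a : ℕ) : ZMod (q * r)) = ((a : ℤ) : ZMod (q * r)) by rw [Int.cast_natCast],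
        MulChar.mul_apply, changeLevel_eq_cast_of_dvd' _ _ hu, changeLevel_eq_cast_of_dvd' _ _ hu,
        Int.cast_natCast, Int.cast_natCast, hχq, hχr, Int.cast_mul]
    · have hnu : ¬ IsUnit ((a : ℕ) : ZMod (q * r)) := by
        rw [ZMod.isUnit_iff_coprime]; exact fun h => hu (Nat.isCoprime_iff_coprime.mpr h)
      rw [MulChar.map_nonunit _ hnu]
      have hc : ¬ a.Coprime (q * r) := fun h => hu (Nat.isCoprime_iff_coprime.mpr h)
      rw [Nat.coprime_mul_iff_right, not_and_or] at hc
      rcases hc with h1 | h1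
      · have hd : q ∣ a := by rwa [Nat.coprime_comm, Nat.Prime.coprime_iff_not_dvd hq.out, not_not] at h1
        rw [(legendreSym.eq_zero_iff q (a : ℤ)).mpr (by rw [Int.cast_natCast]; exact (ZMod.natCast_eq_zero_iff _ _).mpr hd)]
        simp
      · have hd : r ∣ a := by rwa [Nat.coprime_comm, Nat.Prime.coprime_iff_not_dvd hr.out, not_not] at h1
        rw [(legendreSym.eq_zero_iff r (a : ℤ)).mpr (by rw [Int.cast_natCast]; exact (ZMod.natCast_eq_zero_iff _ _).mpr hd)]
        simp

/-- `(−1/q) = χ₄(q)` at the natural representative `q − 1` of `−1`. [cite: Cox2013, §1.C (1.15)] -/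
theorem legendreSym_pred_eq_chiFour {q : ℕ} [hq : Fact q.Prime] (hq2 : q ≠ 2) :
    legendreSym q ((q - 1 : ℕ) : ℤ) = ZMod.χ₄ (q : ZMod 4) := by
  rw [Nat.cast_sub hq.out.one_le, Nat.cast_one, show ((q : ℕ) : ℤ) - 1 = -1 + (q : ℤ) * 1 by ring,
    legendreSym.mod q (-1 + (q : ℤ) * 1), Int.add_mul_emod_self_left, ← legendreSym.mod, legendreSym.at_neg_one hq2]

/-- **`(·/q)(·/r)` is ODD for `q ≡ 1`, `r ≡ 3 (mod 4)`**: `χ(−1) = (−1/q)(−1/r) = (+1)(−1)`. [cite: Cox2013, §1.C (1.15)] -/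
theorem legendrePairChar_odd {q r : ℕ} [hq : Fact q.Prime] [hr : Fact r.Prime] (hq4 : q % 4 = 1) (hr4 : r % 4 = 3)
    (χ : DirichletCharacter ℂ (q * r))
    (hχ : ∀ a : ℕ, χ (a : ZMod (q * r)) = ((legendreSym q (a : ℤ) * legendreSym r (a : ℤ) : ℤ) : ℂ)) : χ.Odd := by
  have hq2 : q ≠ 2 := by omega
  have hr2 : r ≠ 2 := by omega
  have h1 : 1 ≤ q * r := Nat.one_le_iff_ne_zero.mpr (mul_ne_zero hq.out.ne_zero hr.out.ne_zero)
  show χ (-1) = -1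
  have hneg : (-1 : ZMod (q * r)) = ((q * r - 1 : ℕ) : ZMod (q * r)) := by
    rw [Nat.cast_sub h1, Nat.cast_one, ZMod.natCast_self, zero_sub]
  have hmq : legendreSym q ((q * r - 1 : ℕ) : ℤ) = legendreSym q ((q - 1 : ℕ) : ℤ) := by
    rw [legendreSym.mod q ((q * r - 1 : ℕ) : ℤ), legendreSym.mod q ((q - 1 : ℕ) : ℤ)]
    congr 1
    rw [Nat.cast_sub h1, Nat.cast_sub hq.out.one_le]
    push_cast
    rw [show (q : ℤ) * r - 1 = (q : ℤ) - 1 + (r - 1) * q by ring, Int.add_mul_emod_self_right]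
  have hmr : legendreSym r ((q * r - 1 : ℕ) : ℤ) = legendreSym r ((r - 1 : ℕ) : ℤ) := by
    rw [legendreSym.mod r ((q * r - 1 : ℕ) : ℤ), legendreSym.mod r ((r - 1 : ℕ) : ℤ)]
    congr 1
    rw [Nat.cast_sub h1, Nat.cast_sub hr.out.one_le]
    push_cast
    rw [show (q : ℤ) * r - 1 = (r : ℤ) - 1 + (q - 1) * r by ring, Int.add_mul_emod_self_right]
  rw [hneg, hχ, hmq, hmr, legendreSym_pred_eq_chiFour hq2, legendreSym_pred_eq_chiFour hr2, ZMod.χ₄_nat_one_mod_four hq4,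
    ZMod.χ₄_nat_three_mod_four hr4]
  norm_num

/-- `χ₄` as a complex Dirichlet character mod `4`: values `χ₄(a)`, primitive. [cite: Cox2013, §1.C (1.15)] [cite: MontgomeryVaughan2007, Theorem 9.13] -/
theorem exists_chiFourChar :
    ∃ χ : DirichletCharacter ℂ 4, χ.IsPrimitive ∧ ∀ a : ℕ, χ (a : ZMod 4) = ((ZMod.χ₄ (a : ZMod 4) : ℤ) : ℂ) := by
  refine ⟨ZMod.χ₄.ringHomComp (Int.castRingHom ℂ), ?_, fun a => by rw [MulChar.ringHomComp_apply]; rfl⟩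
  refine isPrimitive_of_apply_ne_one _ (c := 2) (fun d hd hne => ?_) (a := 3) (by decide) (by norm_num) ?_
  · have h4 : d ≤ 4 := Nat.le_of_dvd (by norm_num) hd
    interval_cases d <;> simp_all
  · rw [MulChar.ringHomComp_apply]
    have : ZMod.χ₄ ((3 : ℕ) : ZMod 4) = -1 := by decide
    rw [this]; norm_num

/-- **`χ₄·(·/q)(·/r)` as a complex Dirichlet character mod `4qr`** (`q ≠ r` odd primes): PRIMITIVE (conductor `4qr`), with values
`χ₄(a)(a/q)(a/r)`. [cite: Cox2013, §1.C Lemma 1.14 and (1.15)–(1.18)] [cite: MontgomeryVaughan2007, Theorem 9.13] -/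
theorem exists_chiFourPairChar {q r : ℕ} [hq : Fact q.Prime] [hr : Fact r.Prime] (hq2 : q ≠ 2) (hr2 : r ≠ 2) (hqr : q ≠ r) :
    ∃ χ : DirichletCharacter ℂ (4 * q * r), χ.IsPrimitive ∧
      ∀ a : ℕ, χ (a : ZMod (4 * q * r)) =
        (((ZMod.χ₄ (a : ZMod 4) * legendreSym q (a : ℤ) : ℤ) * legendreSym r (a : ℤ) : ℤ) : ℂ) := by
  haveI : NeZero (q * r) := ⟨mul_ne_zero hq.out.ne_zero hr.out.ne_zero⟩
  haveI : NeZero (4 * q * r) := ⟨mul_ne_zero (mul_ne_zero (by norm_num) hq.out.ne_zero) hr.out.ne_zero⟩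
  obtain ⟨χ4, h4p, h4⟩ := exists_chiFourChar
  obtain ⟨χqr, hqrp, hχqr⟩ := exists_legendrePairChar hq2 hr2 hqr
  have hdvd4 : 4 ∣ 4 * q * r := ⟨q * r, by ring⟩
  have hdvdqr : q * r ∣ 4 * q * r := ⟨4, by ring⟩
  refine ⟨changeLevel hdvd4 χ4 * changeLevel hdvdqr χqr, ?_, fun a => ?_⟩
  · have hc4 : χ4.conductor = 4 := h4p
    have hcqr : χqr.conductor = q * r := hqrp
    have hcop : Nat.Coprime 4 (q * r) := by
      rw [show (4 : ℕ) = 2 ^ 2 by norm_num]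
      exact Nat.Coprime.pow_left 2 (Nat.Coprime.mul_right ((Nat.coprime_primes Nat.prime_two hq.out).mpr (Ne.symm hq2))
        ((Nat.coprime_primes Nat.prime_two hr.out).mpr (Ne.symm hr2)))
    rw [isPrimitive_def, conductor_changeLevel_mul_changeLevel _ _ χ4 χqr (by rw [hc4, hcqr]; exact hcop), hc4, hcqr]
    ring
  · by_cases hu : IsCoprime (a : ℤ) ((4 * q * r : ℕ) : ℤ)
    · have hu4 : IsCoprime (a : ℤ) ((4 : ℕ) : ℤ) := hu.of_isCoprime_of_dvd_right (by exact_mod_cast hdvd4)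
      have huqr : IsCoprime (a : ℤ) ((q * r : ℕ) : ℤ) := hu.of_isCoprime_of_dvd_right (by exact_mod_cast hdvdqr)
      rw [show ((a : ℕ) : ZMod (4 * q * r)) = ((a : ℤ) : ZMod (4 * q * r)) by rw [Int.cast_natCast],
        MulChar.mul_apply, changeLevel_eq_cast_of_dvd' _ _ hu, changeLevel_eq_cast_of_dvd' _ _ hu,
        Int.cast_natCast, Int.cast_natCast, h4, hχqr]
      push_cast; ring
    · have hnu : ¬ IsUnit ((a : ℕ) : ZMod (4 * q * r)) := by
        rw [ZMod.isUnit_iff_coprime]; exact fun h => hu (Nat.isCoprime_iff_coprime.mpr h)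
      rw [MulChar.map_nonunit _ hnu]
      have hc : ¬ a.Coprime (4 * q * r) := fun h => hu (Nat.isCoprime_iff_coprime.mpr h)
      rw [mul_assoc, Nat.coprime_mul_iff_right, not_and_or, Nat.coprime_mul_iff_right, not_and_or] at hc
      rcases hc with h1 | h1 | h1
      · have h2 : ¬ a.Coprime 2 := fun h => h1 (by
          rw [show (4 : ℕ) = 2 ^ 2 by norm_num]; exact Nat.Coprime.pow_right 2 h)
        have hev : a % 2 = 0 := by
          rw [Nat.coprime_comm, Nat.Prime.coprime_iff_not_dvd Nat.prime_two, not_not] at h2; omega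
        rw [ZMod.χ₄_nat_eq_if_mod_four, if_pos hev]; simp
      · have hd : q ∣ a := by rwa [Nat.coprime_comm, Nat.Prime.coprime_iff_not_dvd hq.out, not_not] at h1
        rw [(legendreSym.eq_zero_iff q (a : ℤ)).mpr (by rw [Int.cast_natCast]; exact (ZMod.natCast_eq_zero_iff _ _).mpr hd)]
        simp
      · have hd : r ∣ a := by rwa [Nat.coprime_comm, Nat.Prime.coprime_iff_not_dvd hr.out, not_not] at h1
        rw [(legendreSym.eq_zero_iff r (a : ℤ)).mpr (by rw [Int.cast_natCast]; exact (ZMod.natCast_eq_zero_iff _ _).mpr hd)]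
        simp

/-- **`χ₄·(·/q)(·/r)` is ODD for `q ≡ r ≡ 3 (mod 4)`**: `χ(−1) = χ₄(−1)(−1/q)(−1/r) = (−1)(−1)(−1)`. [cite: Cox2013, §1.C (1.15)] -/
theorem chiFourPairChar_odd {q r : ℕ} [hq : Fact q.Prime] [hr : Fact r.Prime] (hq4 : q % 4 = 3) (hr4 : r % 4 = 3)
    (χ : DirichletCharacter ℂ (4 * q * r))
    (hχ : ∀ a : ℕ, χ (a : ZMod (4 * q * r)) =
      (((ZMod.χ₄ (a : ZMod 4) * legendreSym q (a : ℤ) : ℤ) * legendreSym r (a : ℤ) : ℤ) : ℂ)) : χ.Odd := by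
  have hq2 : q ≠ 2 := by omega
  have hr2 : r ≠ 2 := by omega
  have h1 : 1 ≤ 4 * q * r := Nat.one_le_iff_ne_zero.mpr (mul_ne_zero (mul_ne_zero (by norm_num) hq.out.ne_zero) hr.out.ne_zero)
  show χ (-1) = -1
  have hneg : (-1 : ZMod (4 * q * r)) = ((4 * q * r - 1 : ℕ) : ZMod (4 * q * r)) := by
    rw [Nat.cast_sub h1, Nat.cast_one, ZMod.natCast_self, zero_sub]
  have hqr1 : 1 ≤ q * r := Nat.one_le_iff_ne_zero.mpr (mul_ne_zero hq.out.ne_zero hr.out.ne_zero)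
  have hm4 : ZMod.χ₄ ((4 * q * r - 1 : ℕ) : ZMod 4) = -1 :=
    ZMod.χ₄_nat_three_mod_four (by rw [mul_assoc]; omega)
  have hmq : legendreSym q ((4 * q * r - 1 : ℕ) : ℤ) = legendreSym q ((q - 1 : ℕ) : ℤ) := by
    rw [legendreSym.mod q ((4 * q * r - 1 : ℕ) : ℤ), legendreSym.mod q ((q - 1 : ℕ) : ℤ)]
    congr 1
    rw [Nat.cast_sub h1, Nat.cast_sub hq.out.one_le]
    push_cast
    rw [show (4 : ℤ) * q * r - 1 = (q : ℤ) - 1 + (4 * r - 1) * q by ring, Int.add_mul_emod_self_right]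
  have hmr : legendreSym r ((4 * q * r - 1 : ℕ) : ℤ) = legendreSym r ((r - 1 : ℕ) : ℤ) := by
    rw [legendreSym.mod r ((4 * q * r - 1 : ℕ) : ℤ), legendreSym.mod r ((r - 1 : ℕ) : ℤ)]
    congr 1
    rw [Nat.cast_sub h1, Nat.cast_sub hr.out.one_le]
    push_cast
    rw [show (4 : ℤ) * q * r - 1 = (r : ℤ) - 1 + (4 * q - 1) * r by ring, Int.add_mul_emod_self_right]
  rw [hneg, hχ, hm4, hmq, hmr, legendreSym_pred_eq_chiFour hq2, legendreSym_pred_eq_chiFour hr2,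
    ZMod.χ₄_nat_three_mod_four hq4, ZMod.χ₄_nat_three_mod_four hr4]
  norm_num

end Characters

end Summit.BirchSwinnertonDyer.BirchSwinnertonDyer.Theorems.KrizLiCornerClassNumber

end
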